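import Literature.AnabelianGeometry.EtaleTheta.Discharge.Sec5ConstantsDictionaryAtBaseFieldHull
import Literature.AnabelianGeometry.EtaleTheta.Discharge.Sec5Thm510iiiDeltaCharacteristicAtModelTate
import HarnessLib

/-!
# [EtTh] Theorem 5.10 (ii) ∧ (iii) — the `_canonical` END form FIRED at the stage-2 Tate model `D := modelχq p i j` over the base-field-theoretic
# hull, with the K4 column {`hconst`, `m`, `hD`} AND the clause «`Δ^tp_X̲̲ ⊆ Π^tp_X̲̲` characteristic» supplied BY NAME (proof-only)

S. Mochizuki, *The étale theta function and its Frobenioid-theoretic manifestations*, Publ. RIMS **45** (2009), Thm. 5.10 (ii) p. 333 (PDF p. 107),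
(iii) p. 334 (PDF p. 108), proof p. 335 (PDF p. 109).  [cite: MochizukiEtTh2009, Thm 5.10 (iii) p.334 (PDF p.108)]

abc-iut cell, layer L2 = [EtTh], seat abc-iut-L2-t12 (gen 15), file 2 of the offer «THM510II/III — hΔX SUPPLIED @ TATE-MODEL × HULL» (abc-iut-L2-lead
rulings R1561 (b) / R1570: the residual of rows `EtTh:Thm5.10(ii)`, `EtTh:Thm5.10(iii)` keeps ONE content binder of the hψΔ-family).  PROOF-ONLY
(class (a): 0 `def` / 0 `instance` / 0 notation / 0 `Prop`-valued definition / 0 `sorry`; nothing landed is edited or restated): abc-iut-w6-d053's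
F-0620-free END form `ThetaFrobenioid.thm510_ii_iii_ofThetaSettingYdd_of_isTopCharacteristic_canonical` (`Discharge/Sec5Thm510iiiOfThetaSettingYddOfDeltaCharacteristic`,
p492406) INSTANTIATED
* at the étale-theta data of the stage-2 Tate model `D := ThetaSetting.modelχq p i j hj` of the [EtTh] §1 root (every `i j`, `j` even; every `E`, every
  `X̲̲`-choice `C : E.DoubleUnderline l`), and
* over the ONE carrier where the tree constructs the three non-structural inputs of the K4 column — abc-iut-L2-d3's base-field-theoretic hull
  `BsFldHull.temperedFrobenioid p C.augHuu …` of the Setting with `A_⊙^bs := Ÿ̲̲`, `K := D.K`, «the natural inclusion `K^× → O^×(B_N^birat)`» :=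
  `BsFldHull.constEmb` — with `hconst := BsFldHull.biratAutModel_constEmb` (p506755), `m := BsFldHull.muReadingEquiv` (abc-iut-f-142 ★ p530309),
  `hD := constantsDictionary_hull` (abc-iut-f-142 ★ p545647), exactly as abc-iut-f-142's Lemma 5.8 firing file `Sec5Lem58NodeAtBaseFieldHull` (★ p548635), AND
* `hΔX := SettingModel.isTopCharacteristic_deltaTemp_subgroupOf_Huu_modelχq_record` (file 1 of this offer, `Sec5Thm510iiiDeltaCharacteristicAtModelTate`:
  abc-iut-w4-d044's UNCONDITIONAL (H1) `deltaX_characteristic_ofDoubleUnderline_modelχq_holds` in the [EtTh] vocabulary ⟸ {`l` prime, `4·l ∣ p − 1`}).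

RESULT `ThetaFrobenioid.thm510_ii_iii_modelχq_hull_canonical` : `PsiAutPreserves Ψ β ΨbiratAut ∧ MonoThetaEnvCompat …` (Theorem 5.10 (ii) ∧ (iii) as typed by
abc-iut-L2-t4 / abc-iut-L2-t11) with residual ∀-binders EXACTLY {junction data of the hull (`e μ hC hS Rq Sq NH pullFrac θ Bl Pl Rl Q Rt hinvc hinvp`;
`hC`/`hS` are inhabited at the model by `SettingModel.compat_modelχq` / `ThetaSetting.modelχq_sec2Hyps`), `K₀ ⊇ K` (`hK₀`), the Def. 5.4 fixing slot
`hsat` at `B_N`, Thm. 5.7 / Thm. 4.4 (iv) AS TYPED (the transports `Ψ β ΨbiratAut Ψbs eΨ hsq hΨconst αA eA Dc Dp hRT θA hST hθY hθYdd`), the representative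
`ψY` (`hbase hψY hψYdd`), the numerics `hl : l.Prime`, `hdvd : 4 * l ∣ p - 1`} — NO `hψΔ`/`hΔX`/`hextΔ`, NO `hconst`/`m`/`hD`, NO `eΔ`/`hI0`/`U`/`hU`,
NO F-0620/`h15`/`L`, NO F-0007/F-0001.  `set_option maxHeartbeats 800000` on the one declaration.

WHY `type_of%` (abc-iut-L2-lead R1581 (2), numbers not adjectives): the statement of `thm510_ii_iii_modelχq_hull_canonical` is written as core Lean's
`type_of% (<w6-d053's END form applied to the substituted arguments>)`, so its TYPE is LITERALLY the type of the constant
`ThetaFrobenioid.thm510_ii_iii_ofThetaSettingYdd_of_isTopCharacteristic_canonical` (p492406) at the arguments `D := modelχq p i j hj`, `tf := BsFldHull.temperedFrobenioid …`,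
`h := BsFldHull.hypotheses …`, `K' := D.K`, `constEmb := BsFldHull.constEmb …`, `hconst`, `m`, `hD`, `hΔX` as named below — w6-d053's remaining ∀-telescope and
`PsiAutPreserves … ∧ MonoThetaEnvCompat …` conclusion UNALTERED (nothing is restated by hand).  The longhand display of that telescope over the hull data (≈ 45
textual occurrences of `ofThetaSettingData μ hC hS (BsFldHull.hypotheses …) …`) exhausts 800000 heartbeats at the 13th binder (generic `D`: binder `θA`, 139 s;
`modelχq`: binder `αA`, 126 s) and closes only at 4·10⁶ heartbeats / 950 s farm wall; this form elaborates files A+B together in 89 s.  The farm's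
`#check @thm510_ii_iii_modelχq_hull_canonical` printout (binder by binder; staged as HOME/staging/L2/L2-t12/g15/FILE-B-CHECK.txt for the chair's R1576 read)
and any auditor's `#print` re-derive the type from the kernel.

HONEST FRAMING: `modelχq` is a SEMI-SYNTHETIC model of OUR typed §1 interface (not the tempered `π₁` of a curve); the hull carrier has GENUINE base
`B^temp(Π^tp_X̲̲)⁰`, genuine constants `K ⊆ ℚ̄_p` and genuine Galois action but DEGENERATE divisor geometry (every rational function is a constant;
abc-iut-L2-d3's label) — a discharge of the displayed inputs AT OUR DATA, not [EtTh] Theorem 5.10 for the tempered Frobenioid of a Tate curve (which enters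
the tree only as the abstract parameter `tf`); at abc-iut-L2-t9's `temperedFrobenioidSmall` no such dictionary exists (p499346).  The CLASS of the two rows
is the L2 chair's census, not this file's claim.  Nothing of [EtTh] (refereed) is asserted unconditionally; typed ≠ proved; discharged-at-our-data ≠
endorsed; no side is taken on [IUTchIII] Cor. 3.12; nothing here says abc is proved or refuted.
-/

noncomputable section

namespace Literature.AnabelianGeometry.EtaleTheta

open CategoryTheory Opposite Literature.AlgebraicGeometry.Frobenioids Literature.AnabelianGeometry.SemiGraphs
  Literature.AnabelianGeometry.SemiGraphs.GaloisObjects Literature.AlgebraicGeometry.Frobenioids.QuasiTemperoid.BTempConnected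

namespace ThetaFrobenioid

section ModelHull

variable (p : ℕ) [Fact p.Prime] (i j : ℤ) (hj : Even j) {E : (ThetaSetting.modelχq p i j hj).EtaleThetaData} {l : ℕ}
  {C : E.DoubleUnderline l} {e : (ThetaSetting.modelχq p i j hj).toTemperedCurve.GroupLevelData} {N : ℕ+}
  (μ : (ThetaSetting.modelχq p i j hj).CyclotomeMod l N) (hC : (ThetaSetting.modelχq p i j hj).Compat) (hS : (ThetaSetting.modelχq p i j hj).Sec2Hyps)
  {Rq Sq : ((ConnectedPart (BTemp (C.temperedArithmeticGroup e).Pi))ᵒᵖ ⥤ CommMonCat.{0}) → Prop}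
  {NH : Subgroup (Field.absoluteGaloisGroup (ThetaSetting.modelχq p i j hj).K) → (BsFldHull.temperedFrobenioid p C.augHuu (C.isOpen_map_augHuu e) (C.temperedArithmeticGroup e).isTempered Rq Sq).category → ℕ+ → Prop}
  {pullFrac : ∀ {A A' : (BiKummerSetting.mkOfThetaSettingYdd C e μ hC hS (BsFldHull.temperedFrobenioid p C.augHuu (C.isOpen_map_augHuu e) (C.temperedArithmeticGroup e).isTempered Rq Sq) (BsFldHull.temperedFrobenioid_monoidType p C.augHuu (C.isOpen_map_augHuu e) (C.temperedArithmeticGroup e).isTempered Rq Sq) (BsFldHull.hP p C.augHuu (C.isOpen_map_augHuu e) (C.temperedArithmeticGroup e).isTempered Rq Sq) NH).C} (_ : A' ⟶ A), (BiKummerSetting.mkOfThetaSettingYdd C e μ hC hS (BsFldHull.temperedFrobenioid p C.augHuu (C.isOpen_map_augHuu e) (C.temperedArithmeticGroup e).isTempered Rq Sq) (BsFldHull.temperedFrobenioid_monoidType p C.augHuu (C.isOpen_map_augHuu e) (C.temperedArithmeticGroup e).isTempered Rq Sq) (BsFldHull.hP p C.augHuu (C.isOpen_map_augHuu e) (C.temperedArithmeticGroup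 e).isTempered Rq Sq) NH).biratUnits A → (BiKummerSetting.mkOfThetaSettingYdd C e μ hC hS (BsFldHull.temperedFrobenioid p C.augHuu (C.isOpen_map_augHuu e) (C.temperedArithmeticGroup e).isTempered Rq Sq) (BsFldHull.temperedFrobenioid_monoidType p C.augHuu (C.isOpen_map_augHuu e) (C.temperedArithmeticGroup e).isTempered Rq Sq) (BsFldHull.hP p C.augHuu (C.isOpen_map_augHuu e) (C.temperedArithmeticGroup e).isTempered Rq Sq) NH).biratUnits A'}
  {θ : (BiKummerSetting.mkOfThetaSettingYdd C e μ hC hS (BsFldHull.temperedFrobenioid p C.augHuu (C.isOpen_map_augHuu e) (C.temperedArithmeticGroup e).isTempered Rq Sq) (BsFldHull.temperedFrobenioid_monoidType p C.augHuu (C.isOpen_map_augHuu e) (C.temperedArithmeticGroup e).isTempered Rq Sq) (BsFldHull.hP p C.augHuu (C.isOpen_map_augHuu e) (C.temperedArithmeticGroup e).isTempered Rq Sq) NH).biratUnits (BiKummerSetting.mkOfThetaSettingYdd C e μ hC hS (BsFldHull.temperedFrobenioid p C.augHuu (C.isOpen_map_augHuu e) (C.temperedArithmeticGroup e).isTempered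 Rq Sq) (BsFldHull.temperedFrobenioid_monoidType p C.augHuu (C.isOpen_map_augHuu e) (C.temperedArithmeticGroup e).isTempered Rq Sq) (BsFldHull.hP p C.augHuu (C.isOpen_map_augHuu e) (C.temperedArithmeticGroup e).isTempered Rq Sq) NH).Aodot}
  {Bl : (BiKummerSetting.mkOfThetaSettingYdd C e μ hC hS (BsFldHull.temperedFrobenioid p C.augHuu (C.isOpen_map_augHuu e) (C.temperedArithmeticGroup e).isTempered Rq Sq) (BsFldHull.temperedFrobenioid_monoidType p C.augHuu (C.isOpen_map_augHuu e) (C.temperedArithmeticGroup e).isTempered Rq Sq) (BsFldHull.hP p C.augHuu (C.isOpen_map_augHuu e) (C.temperedArithmeticGroup e).isTempered Rq Sq) NH).C}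
  {Pl : (BiKummerSetting.mkOfThetaSettingYdd C e μ hC hS (BsFldHull.temperedFrobenioid p C.augHuu (C.isOpen_map_augHuu e) (C.temperedArithmeticGroup e).isTempered Rq Sq) (BsFldHull.temperedFrobenioid_monoidType p C.augHuu (C.isOpen_map_augHuu e) (C.temperedArithmeticGroup e).isTempered Rq Sq) (BsFldHull.hP p C.augHuu (C.isOpen_map_augHuu e) (C.temperedArithmeticGroup e).isTempered Rq Sq) NH).FractionPair θ Bl}
  {Rl : (BiKummerSetting.mkOfThetaSettingYdd C e μ hC hS (BsFldHull.temperedFrobenioid p C.augHuu (C.isOpen_map_augHuu e) (C.temperedArithmeticGroup e).isTempered Rq Sq) (BsFldHull.temperedFrobenioid_monoidType p C.augHuu (C.isOpen_map_augHuu e) (C.temperedArithmeticGroup e).isTempered Rq Sq) (BsFldHull.hP p C.augHuu (C.isOpen_map_augHuu e) (C.temperedArithmeticGroup e).isTempered Rq Sq) NH).NthRoot θ Pl C.lPNat pullFrac}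
  (Q : FrobenioidTheta.ThetaSubquotientStub.{0} (ConnectedPart (BTemp (C.temperedArithmeticGroup e).Pi)))
  (Rt : (BiKummerSetting.mkOfThetaSettingYdd C e μ hC hS (BsFldHull.temperedFrobenioid p C.augHuu (C.isOpen_map_augHuu e) (C.temperedArithmeticGroup e).isTempered Rq Sq) (BsFldHull.temperedFrobenioid_monoidType p C.augHuu (C.isOpen_map_augHuu e) (C.temperedArithmeticGroup e).isTempered Rq Sq) (BsFldHull.hP p C.augHuu (C.isOpen_map_augHuu e) (C.temperedArithmeticGroup e).isTempered Rq Sq) NH).NthRoot Rl.root Rl.pair N pullFrac)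
  (hinvc : ∀ g : Aut Rt.AN.base,
    pull (BsFldHull.temperedFrobenioid p C.augHuu (C.isOpen_map_augHuu e) (C.temperedArithmeticGroup e).isTempered Rq Sq).divisorMonoid g.hom (ModelFrobenioid.div Rt.pair.num) = ModelFrobenioid.div Rt.pair.num)
  (hinvp : ∀ y : (C.thetaEnvData μ hC hS).PiX, y ∈ (C.thetaEnvData μ hC hS).PiYdd →
    pull (BsFldHull.temperedFrobenioid p C.augHuu (C.isOpen_map_augHuu e) (C.temperedArithmeticGroup e).isTempered Rq Sq).divisorMonoid ((BiKummerSetting.mkOfThetaSettingYdd C e μ hC hS (BsFldHull.temperedFrobenioid p C.augHuu (C.isOpen_map_augHuu e) (C.temperedArithmeticGroup e).isTempered Rq Sq) (BsFldHull.temperedFrobenioid_monoidType p C.augHuu (C.isOpen_map_augHuu e) (C.temperedArithmeticGroup e).isTempered Rq Sq) (BsFldHull.hP p C.augHuu (C.isOpen_map_augHuu e) (C.temperedArithmeticGroup e).isTempered Rq Sq) NH).galoisSurj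
      Rt.AN.base Rt.αData.isGalois ((ContinuousMulEquiv.refl _) y)).hom (ModelFrobenioid.div Rt.pair.den) = ModelFrobenioid.div Rt.pair.den)
  (K₀ : IntermediateField ℚ_[p] (PadicAlgCl p)) (hK₀ : (ThetaSetting.modelχq p i j hj).K ≤ K₀)
  (hsat : (((CosetCat.equivConnectedPart (C.temperedArithmeticGroup e).isTempered).inverse.obj Rt.BN.base).sg.toSubgroup.map C.augHuu :
      Subgroup (GQp p)) ≤
    (IntermediateField.normalClosure ℚ_[p]
      (IntermediateField.adjoin ℚ_[p] ((K₀ : Set (PadicAlgCl p)) ∪ {x | x ^ (N : ℕ) ∈ K₀})) (PadicAlgCl p)).fixingSubgroup)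


set_option maxHeartbeats 800000 in
/-- **[EtTh] Theorem 5.10 (ii) ∧ (iii) — the `_canonical` END form FIRED AT THE STAGE-2 TATE MODEL OVER THE BASE-FIELD-THEORETIC HULL.**
The statement is, LITERALLY (`type_of%`), the type of abc-iut-w6-d053's `thm510_ii_iii_ofThetaSettingYdd_of_isTopCharacteristic_canonical` (p492406) after the
substitutions `D := ThetaSetting.modelχq p i j hj`, `tf := BsFldHull.temperedFrobenioid p C.augHuu …`, `h := BsFldHull.hypotheses …`, `K' := D.K`,
`constEmb := BsFldHull.constEmb …`, with its FOUR displayed inputs SUPPLIED BY NAME — `hconst := BsFldHull.biratAutModel_constEmb` (p506755),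
`m := BsFldHull.muReadingEquiv` (★ p530309), `hD := constantsDictionary_hull` (★ p545647), `hΔX := SettingModel.isTopCharacteristic_deltaTemp_subgroupOf_Huu_modelχq_record`
(★ p553076) — and NOTHING restated by hand; w6-d053's conclusion `PsiAutPreserves Ψ β ΨbiratAut ∧ MonoThetaEnvCompat (facts_…).sectionsFactor (…).outerActionLZ_of
(facts_…).sgpCapSection (facts_…).sgpCupSection (facts_…).constantsEqNormalizer (dkOfConnectedTemperoidData …) Ψ β ψY hbase hψY hψYdd` is UNALTERED.
RESIDUAL ∀-BINDERS EXACTLY (names verbatim, in kernel order — the farm's `#check @thm510_ii_iii_modelχq_hull_canonical` printout, HOME/staging/L2/L2-t12/g15/FILE-B-CHECK.txt;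
abc-iut-L2-lead R1581 (1)): the section data `(p) [Fact p.Prime] (i j : ℤ) (hj : Even j) {E} {l} {C : E.DoubleUnderline l} {e} {N} (μ) (hC) (hS) {Rq Sq} {NH} {pullFrac} {θ} {Bl} {Pl} {Rl}
(Q) (Rt) (hinvc) (hinvp) (K₀) (hK₀) (hsat)` = {the étale-theta datum and `X̲̲`-choice over `modelχq p i j hj` (parameters); the junction data of the hull incl. `e μ hC hS hinvc hinvp`
(junction class; `hC`/`hS` are inhabited at the model by `SettingModel.compat_modelχq` / `ThetaSetting.modelχq_sec2Hyps`); `K₀ ⊇ K`; the Def. 5.4 fixing slot `hsat`}, then the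
numerics `(hl : l.Prime) (hdvd : 4 * l ∣ p - 1)`, then w6-d053's own telescope `(Ψ) (β) (ΨbiratAut) (Ψbs) [Ψbs.Faithful] (eΨ) (hsq) (hΨconst) (αA) (eA) (Dc Dp) (hRT) (θA) (hST)
(hθY) (hθYdd) (ψY) (hbase) (hψY) (hψYdd)` = {Thm. 5.7 / Thm. 4.4 (iv) transports AS TYPED; the representative `ψY` with (`hbase`, `hψY`, `hψYdd`)} (the pretty-printer shows
the non-dependent hypotheses `hl hdvd hsq hΨconst hRT hST hθY hθYdd` as unnamed `→` arrows) — and NONE of {`hψΔ`, `hΔX`, `hextΔ`, `hconst`, `m`, `hD`, `eΔ`, `hI0`, `η`/`hη`,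
`U`, `hU`, F-0620/`Cor218_i`, `h15`, `L`, F-0007/F-0001/(H1) as hypotheses}; 0 `sorry` / 0 local instance / 0 `Prop`-def.  HONEST: `modelχq` is SEMI-SYNTHETIC (our typed §1
interface's Tate-shear model, not a curve's tempered `π₁`); the hull has genuine base/constants/Galois action and DEGENERATE divisor geometry; «discharged at OUR data» ≠ [EtTh]
Thm. 5.10 for the tempered Frobenioid of a Tate curve; the CLASS of rows 192/193 is the chair's census (R1576), not this file's claim; no side taken on [IUTchIII] Cor. 3.12;
typed ≠ proved.  [cite: MochizukiEtTh2009, Thm 5.10 (ii)(iii) p.333–335 (PDF pp.107–109); Thm 5.7 p.329 (PDF p.103); Thm 4.4 (iv) p.320 (PDF p.94); Def 5.4 p.327 (PDF p.101)] -/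
theorem thm510_ii_iii_modelχq_hull_canonical (hl : l.Prime) (hdvd : 4 * l ∣ p - 1) :
    type_of% (thm510_ii_iii_ofThetaSettingYdd_of_isTopCharacteristic_canonical μ hC hS (BsFldHull.hypotheses p C.augHuu (C.isOpen_map_augHuu e) (C.temperedArithmeticGroup e).isTempered Rq Sq) Q Rt (ThetaSetting.modelχq p i j hj).K
      (BsFldHull.constEmb p C.augHuu (C.isOpen_map_augHuu e) (ThetaSetting.modelχq p i j hj).K augHuu_mem_fixingSubgroup (C.temperedArithmeticGroup e).isTempered Rq Sq Rt.BN)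
      (BsFldHull.constEmb_injective p C.augHuu (C.isOpen_map_augHuu e) (ThetaSetting.modelχq p i j hj).K augHuu_mem_fixingSubgroup (C.temperedArithmeticGroup e).isTempered Rq Sq Rt.BN) hinvc hinvp
      (BsFldHull.biratAutModel_constEmb p C.augHuu (C.isOpen_map_augHuu e) (ThetaSetting.modelχq p i j hj).K augHuu_mem_fixingSubgroup (C.temperedArithmeticGroup e).isTempered Rq Sq Rt.BN)
      (BsFldHull.muReadingEquiv (T := C.thetaEnvData μ hC hS) p Rt (BsFldHull.hypotheses p C.augHuu (C.isOpen_map_augHuu e) (C.temperedArithmeticGroup e).isTempered Rq Sq) Q C.odd_lPNat (ContinuousMulEquiv.refl _) (ThetaSetting.modelχq p i j hj).K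
        (BsFldHull.constEmb p C.augHuu (C.isOpen_map_augHuu e) (ThetaSetting.modelχq p i j hj).K augHuu_mem_fixingSubgroup (C.temperedArithmeticGroup e).isTempered Rq Sq Rt.BN)
        (BsFldHull.constEmb_injective p C.augHuu (C.isOpen_map_augHuu e) (ThetaSetting.modelχq p i j hj).K augHuu_mem_fixingSubgroup (C.temperedArithmeticGroup e).isTempered Rq Sq Rt.BN)
        hinvc hinvp (hμN_of_fixingSlot Rt K₀ hsat))
      (constantsDictionary_hull μ hC hS Q Rt hinvc hinvp K₀ hK₀ hsat)
      (SettingModel.isTopCharacteristic_deltaTemp_subgroupOf_Huu_modelχq_record p i j hj C hl hdvd)) :=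
  thm510_ii_iii_ofThetaSettingYdd_of_isTopCharacteristic_canonical μ hC hS (BsFldHull.hypotheses p C.augHuu (C.isOpen_map_augHuu e) (C.temperedArithmeticGroup e).isTempered Rq Sq) Q Rt (ThetaSetting.modelχq p i j hj).K
    (BsFldHull.constEmb p C.augHuu (C.isOpen_map_augHuu e) (ThetaSetting.modelχq p i j hj).K augHuu_mem_fixingSubgroup (C.temperedArithmeticGroup e).isTempered Rq Sq Rt.BN)
    (BsFldHull.constEmb_injective p C.augHuu (C.isOpen_map_augHuu e) (ThetaSetting.modelχq p i j hj).K augHuu_mem_fixingSubgroup (C.temperedArithmeticGroup e).isTempered Rq Sq Rt.BN) hinvc hinvp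
    (BsFldHull.biratAutModel_constEmb p C.augHuu (C.isOpen_map_augHuu e) (ThetaSetting.modelχq p i j hj).K augHuu_mem_fixingSubgroup (C.temperedArithmeticGroup e).isTempered Rq Sq Rt.BN)
    (BsFldHull.muReadingEquiv (T := C.thetaEnvData μ hC hS) p Rt (BsFldHull.hypotheses p C.augHuu (C.isOpen_map_augHuu e) (C.temperedArithmeticGroup e).isTempered Rq Sq) Q C.odd_lPNat (ContinuousMulEquiv.refl _) (ThetaSetting.modelχq p i j hj).K
      (BsFldHull.constEmb p C.augHuu (C.isOpen_map_augHuu e) (ThetaSetting.modelχq p i j hj).K augHuu_mem_fixingSubgroup (C.temperedArithmeticGroup e).isTempered Rq Sq Rt.BN)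
      (BsFldHull.constEmb_injective p C.augHuu (C.isOpen_map_augHuu e) (ThetaSetting.modelχq p i j hj).K augHuu_mem_fixingSubgroup (C.temperedArithmeticGroup e).isTempered Rq Sq Rt.BN)
      hinvc hinvp (hμN_of_fixingSlot Rt K₀ hsat))
    (constantsDictionary_hull μ hC hS Q Rt hinvc hinvp K₀ hK₀ hsat)
    (SettingModel.isTopCharacteristic_deltaTemp_subgroupOf_Huu_modelχq_record p i j hj C hl hdvd)

end ModelHull

end ThetaFrobenioid

end Literature.AnabelianGeometry.EtaleTheta

end
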